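import Mathlib
import HarnessLib

/-!
# A binomial growth estimate: `n^c + c < C(n - (c+2), c+2)` for large `n`
(crux `OrbitRestorationQP`, stmt-ValiantsHypothesis-18293 — lane SML: the column-set-multilinear `ΣΠΣ` stratum of A_∞)

F6 (numeric part) of the blueprint `SML-STRATUM-BLUEPRINT.md`: a column-sml `ΣΠΣ` circuit with at most `n^c + c` product
gates has fewer than `C(n-j, j)` gates for `j = c + 2` once `n` is large, so the flattening/narrowness theorem applies with
`j = c + 2` and the power-sum support of the family is `(c+1)`-narrow from some level on. [folklore]
-/

set_option linter.dupNamespace false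

namespace Summit.ValiantsHypothesis.ValiantsHypothesis.Theorems.SmlNumeric

/-- `k! · C(N, k) ≥ (N + 1 - k)^k`. [folklore] -/
theorem pow_le_factorial_mul_choose (N k : ℕ) : (N + 1 - k) ^ k ≤ k.factorial * N.choose k := by
  rw [← Nat.descFactorial_eq_factorial_mul_choose]
  exact Nat.pow_sub_le_descFactorial N k

/-- **Growth estimate.**  For every `c` there is `N₀` with `n^c + c < C(n - (c+2), c+2)` for all `n ≥ N₀`. [folklore] -/
theorem exists_pow_add_lt_choose (c : ℕ) :
    ∃ N₀ : ℕ, ∀ n : ℕ, N₀ ≤ n → n ^ c + c < (n - (c + 2)).choose (c + 2) := by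
  set k := c + 2 with hk
  set K := 2 ^ (c + 3) * k.factorial with hK
  refine ⟨max (4 * c + 6) (K + 1), fun n hn => ?_⟩
  have hn1 : 4 * c + 6 ≤ n := le_trans (le_max_left _ _) hn
  have hn2 : K + 1 ≤ n := le_trans (le_max_right _ _) hn
  have hkpos : 0 < k.factorial := Nat.factorial_pos k
  -- `m = n - 2c - 3` satisfies `2m ≥ n` and `k! C(n-k, k) ≥ m^k`
  have hm : (n - (c + 2)) + 1 - (c + 2) = n - (2 * c + 3) := by omega
  have h1 : (n - (2 * c + 3)) ^ k ≤ k.factorial * (n - (c + 2)).choose k := by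
    have := pow_le_factorial_mul_choose (n - (c + 2)) k
    rw [hm] at this
    exact this
  have h2m : n ≤ 2 * (n - (2 * c + 3)) := by omega
  -- `n^k ≤ 2^k m^k`
  have h2 : n ^ k ≤ 2 ^ k * (n - (2 * c + 3)) ^ k := by
    rw [← mul_pow]; exact Nat.pow_le_pow_left h2m k
  -- `c ≤ n^c`
  have hc : c ≤ n ^ c := by
    rcases Nat.eq_zero_or_pos c with h | h
    · rw [h]; simp
    · calc c ≤ n := by omega
        _ = n ^ 1 := (pow_one n).symm
        _ ≤ n ^ c := Nat.pow_le_pow_right (by omega) h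
  -- main chain, multiplied through by `2^k · k!`
  have hkey : 2 ^ k * k.factorial * (n ^ c + c) < 2 ^ k * k.factorial * (n - (c + 2)).choose k := by
    have hA : 2 ^ k * k.factorial * (n ^ c + c) ≤ 2 ^ (c + 3) * k.factorial * n ^ c := by
      calc 2 ^ k * k.factorial * (n ^ c + c) ≤ 2 ^ k * k.factorial * (2 * n ^ c) :=
            Nat.mul_le_mul_left _ (by omega)
        _ = 2 ^ (c + 3) * k.factorial * n ^ c := by rw [hk]; ring
    have hB : 2 ^ (c + 3) * k.factorial * n ^ c < n * n * n ^ c := by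
      have hpos : 0 < n ^ c := Nat.pow_pos (by omega)
      have : 2 ^ (c + 3) * k.factorial < n * n := by
        calc 2 ^ (c + 3) * k.factorial = K := by rw [hK]
          _ < n := by omega
          _ ≤ n * n := Nat.le_mul_self n
      exact Nat.mul_lt_mul_of_lt_of_le this le_rfl hpos
    have hC : n * n * n ^ c = n ^ k := by rw [hk]; ring
    have hD : n ^ k ≤ 2 ^ k * k.factorial * (n - (c + 2)).choose k := by
      calc n ^ k ≤ 2 ^ k * (n - (2 * c + 3)) ^ k := h2
        _ ≤ 2 ^ k * (k.factorial * (n - (c + 2)).choose k) := Nat.mul_le_mul_left _ h1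
        _ = 2 ^ k * k.factorial * (n - (c + 2)).choose k := by ring
    calc 2 ^ k * k.factorial * (n ^ c + c) ≤ 2 ^ (c + 3) * k.factorial * n ^ c := hA
      _ < n * n * n ^ c := hB
      _ = n ^ k := hC
      _ ≤ 2 ^ k * k.factorial * (n - (c + 2)).choose k := hD
  exact Nat.lt_of_mul_lt_mul_left hkey

end Summit.ValiantsHypothesis.ValiantsHypothesis.Theorems.SmlNumeric
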